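import Summits.CriticalPhenomena.PercolationContinuityZ3.Theorems.Transplant.HexShadowFace
import Summits.CriticalPhenomena.PercolationContinuityZ3.Theorems.Transplant.HexShadowCoarse
import Literature.Probability.Percolation.SlabCriticalityInputs
import HarnessLib

/-!
# HEXAGONAL SHADOWS VI — the FACE coarse lattice `c + 2n·(x₀(2,−1) + x₁(1,1))`, its good-edge configuration, measurability, translation invariance
# and `9`-dependence (towards NODE B of the face route, `HexShadow.FaceRenormalisation`)

builds on p205010 (kernel theorem, internal audit signed; external expert review pending) — NOT used in this file.
Lane `prim-bschramm`, seat `prim-bschramm-p2` (gen 31; class C1b; memo `HOME/bschramm/P2-LATTICES.md` §110); helper file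
(`--supports stmt-CriticalPhenomena-4575 --as helper`).  Interface `Transplant/HexShadowDefs`, tools `Transplant/HexShadowTransport`; slab original
`Literature/…/SlabCriticalityInputs` ll. 135–545; this is the face-direction twin of `Transplant/HexShadowCoarse` (vertex-direction variant), see
`Transplant/HexShadowFace` for why the face lattice is the one DST's §2.1 delivers.

Coarse vertices `x ∈ ℤ²` sit at `c + 2n·faceMap x ∈ 𝕋`, `faceMap x = x₀·(2,−1) + x₁·(1,1)` (`faceCoarsePt`; `triNorm (faceMap x) ≥ ‖x‖_∞`, and `≥ 2` for
`x ≠ 0`); the GOOD-EDGE CONFIGURATION `faceCoarseConfig n u ω ⊆ E(ℤ²)` collects the coarse edges `{x, x+eᵢ}` whose face good event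
`Φ.faceGoodEvent n u (c + 2n·faceMap x) i` occurs; it is a measurable function of `ω`; every coarse edge is good with the probability of the centre edge of
the same direction (`real_faceGoodEvent_coarsePt`, `period ∣ n`); coarse edges at sup-distance `≥ 9` depend on DISJOINT sets of edges of `G` (regions
`hexBall (· + n·faceDir i) 6n`, centres `≥ 2n·9 − 4n = 14n` apart: `disjoint_faceCoarseRegion`).
[cite: DuminilCopinSidoraviciusTassion2016, §2.2 (arXiv p. 9)] [cite: GrimmettPercolation1999, §1.6 p. 16]
-/

noncomputable section

namespace Summit.CriticalPhenomena.PercolationContinuityZ3.Theorems.Transplant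

open MeasureTheory Literature.Probability.Percolation Literature.Probability.LatticeModels SimpleGraph Filter
open scoped Classical

/-! ## §1 The linear map of the face lattice -/

/-- The face lattice map `x ↦ x₀·(2,−1) + x₁·(1,1) = (2x₀ + x₁, x₁ − x₀)`. [folklore] -/
def faceMap (x : Site 2) : Site 2 := x 0 • faceDir 0 + x 1 • faceDir 1

/-- Coordinates of `faceMap`. [folklore] -/
theorem faceMap_apply (x : Site 2) : faceMap x = ![2 * x 0 + x 1, -x 0 + x 1] := by
  ext j; fin_cases j <;> simp [faceMap, faceDir]
  ring

/-- `faceMap` is additive. [folklore] -/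
theorem faceMap_add (x y : Site 2) : faceMap (x + y) = faceMap x + faceMap y := by
  simp only [faceMap, Pi.add_apply, add_smul]; abel

/-- `faceMap` is compatible with subtraction. [folklore] -/
theorem faceMap_sub (x y : Site 2) : faceMap (x - y) = faceMap x - faceMap y := by
  simp only [faceMap, Pi.sub_apply, sub_smul]; abel

/-- `faceMap` of a unit vector is the face direction. [folklore] -/
theorem faceMap_single (i : Fin 2) : faceMap (Pi.single i 1) = faceDir i := by
  fin_cases i <;> simp [faceMap]

/-- **The face lattice map dominates the sup norm**: `|x₀|, |x₁| ≤ triNorm (faceMap x)` (`3x₀ = (2x₀+x₁) − (x₁−x₀)`, `3x₁ = (2x₀+x₁) + 2(x₁−x₀)`). [folklore] -/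
theorem abs_le_triNorm_faceMap (x : Site 2) : |x 0| ≤ triNorm (faceMap x) ∧ |x 1| ≤ triNorm (faceMap x) := by
  rw [faceMap_apply]
  set T := triNorm (![2 * x 0 + x 1, -x 0 + x 1] : Site 2) with hT
  have h1 : |2 * x 0 + x 1| ≤ T := (abs_le_triNorm (![2 * x 0 + x 1, -x 0 + x 1] : Site 2)).1
  have h2 : |-x 0 + x 1| ≤ T := (abs_le_triNorm (![2 * x 0 + x 1, -x 0 + x 1] : Site 2)).2
  rw [abs_le] at h1 h2
  constructor <;> rw [abs_le] <;> constructor <;> omega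

/-- **Non-zero coarse vertices are at face distance `≥ 2`**: `x ≠ 0 ⇒ triNorm (faceMap x) ≥ 2`. [folklore] -/
theorem two_le_triNorm_faceMap {x : Site 2} (hx : x ≠ 0) : 2 ≤ triNorm (faceMap x) := by
  have hne : x 0 ≠ 0 ∨ x 1 ≠ 0 := by
    by_contra h; push Not at h; exact hx (by ext j; fin_cases j <;> simp [h.1, h.2])
  rw [faceMap_apply]
  simp only [triNorm, Matrix.cons_val_zero, Matrix.cons_val_one, le_max_iff, le_abs]
  omega

/-- The triangle inequality for `triNorm` in distance form (private copy). [folklore] -/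
private theorem triNorm_sub_le_triNorm_sub_add (u v w : Site 2) : triNorm (u - w) ≤ triNorm (u - v) + triNorm (v - w) := by
  simp only [triNorm, Pi.sub_apply, max_le_iff]
  have l0 := (abs_le_triNorm (u - v)).1; have l1 := (abs_le_triNorm (u - v)).2
  have l2 : |(u - v) 0 + (u - v) 1| ≤ triNorm (u - v) := (le_max_right _ _).trans (le_max_right _ _)
  have m0 := (abs_le_triNorm (v - w)).1; have m1 := (abs_le_triNorm (v - w)).2
  have m2 : |(v - w) 0 + (v - w) 1| ≤ triNorm (v - w) := (le_max_right _ _).trans (le_max_right _ _)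
  simp only [triNorm, Pi.sub_apply] at l0 l1 l2 m0 m1 m2 ⊢
  rw [abs_le] at l0 l1 l2 m0 m1 m2
  refine ⟨abs_le.2 ⟨?_, ?_⟩, abs_le.2 ⟨?_, ?_⟩, abs_le.2 ⟨?_, ?_⟩⟩ <;> linarith

namespace HexShadow

variable {V : Type} {G : SimpleGraph V} (Φ : HexShadow G)

/-! ## §2 The face coarse lattice and its good-edge configuration -/

/-- The base point `c + 2n·faceMap x ∈ 𝕋` of the coarse vertex `x ∈ ℤ²` of the face lattice. [cite: DuminilCopinSidoraviciusTassion2016, §2.2] -/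
def faceCoarsePt (n : ℕ) (x : Site 2) : Site 2 := Φ.centre + ((2 * n : ℕ) : ℤ) • faceMap x

/-- `faceCoarsePt` of a coarse neighbour: `c + 2n·faceMap (x + eᵢ) = (c + 2n·faceMap x) + 2n·faceDir i`. [folklore] -/
theorem faceCoarsePt_add_single (n : ℕ) (x : Site 2) (i : Fin 2) :
    Φ.faceCoarsePt n (x + Pi.single i 1) = Φ.faceCoarsePt n x + (2 * (n : ℤ)) • faceDir i := by
  simp only [faceCoarsePt, faceMap_add, faceMap_single, smul_add]; push_cast; abel

/-- `faceCoarsePt n 0 = c`. [folklore] -/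
@[simp] theorem faceCoarsePt_zero (n : ℕ) : Φ.faceCoarsePt n 0 = Φ.centre := by simp [faceCoarsePt, faceMap]

/-- **The good-edge configuration**: the nearest-neighbour edges `{x, x + eᵢ}` of the coarse lattice `ℤ²` whose good-edge event at `c + 4n x` occurs.
[cite: DuminilCopinSidoraviciusTassion2016, §2.2 ("Call an edge {z,z'} of 4nℤ² good if …")] -/
def faceCoarseConfig (n u : ℕ) (ω : BondConfig V) : BondConfig (Site 2) :=
  {e | ∃ (x : Site 2) (i : Fin 2), e = s(x, x + Pi.single i 1) ∧ ω ∈ Φ.faceGoodEvent n u (Φ.faceCoarsePt n x) i}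

/-- Membership of a coarse edge in the good-edge configuration. [cite: DuminilCopinSidoraviciusTassion2016, §2.2] -/
theorem mk_mem_faceCoarseConfig_iff (n u : ℕ) (ω : BondConfig V) (x : Site 2) (i : Fin 2) :
    s(x, x + Pi.single i 1) ∈ Φ.faceCoarseConfig n u ω ↔ ω ∈ Φ.faceGoodEvent n u (Φ.faceCoarsePt n x) i := by
  constructor
  · rintro ⟨x', j, he, hg⟩
    obtain ⟨rfl, rfl⟩ := (coarseEdge_eq_iff x x' i j).1 he
    exact hg
  · intro h
    exact ⟨x, i, rfl, h⟩

/-- The good-edge configuration is a measurable function of the configuration of `G`. [cite: DuminilCopinSidoraviciusTassion2016, §2.2] -/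
theorem measurable_faceCoarseConfig (n u : ℕ) : Measurable (Φ.faceCoarseConfig n u) := by
  refine measurable_set_iff.2 fun e => ?_
  refine measurableSet_setOf.1 ?_
  have : {ω : BondConfig V | e ∈ Φ.faceCoarseConfig n u ω} =
      ⋃ x : Site 2, ⋃ i : Fin 2, {ω | e = s(x, x + Pi.single i 1) ∧ ω ∈ Φ.faceGoodEvent n u (Φ.faceCoarsePt n x) i} := by
    ext ω
    simp only [faceCoarseConfig, Set.mem_setOf_eq, Set.mem_iUnion]
  rw [this]
  refine MeasurableSet.iUnion fun x => MeasurableSet.iUnion fun i => ?_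
  by_cases he : e = s(x, x + Pi.single i 1)
  · simp only [he, true_and]
    exact Φ.measurableSet_faceGoodEvent n u _ i
  · simp only [he, false_and, Set.setOf_false]
    exact MeasurableSet.empty

/-- **Every coarse edge of direction `i` is good with the probability of the centre edge of direction `i`** (`period ∣ n`).
[cite: DuminilCopinSidoraviciusTassion2016, §2.2 ("the probability to be good")] -/
theorem real_faceGoodEvent_coarsePt [Countable V] (p : unitInterval) {n : ℕ} (hdvd : Φ.period ∣ n) (u : ℕ) (x : Site 2) (i : Fin 2) :
    (bondPercolation G p).real (Φ.faceGoodEvent n u (Φ.faceCoarsePt n x) i) = (bondPercolation G p).real (Φ.faceGoodEvent n u Φ.centre i) := by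
  obtain ⟨m, hm⟩ := hdvd
  have e : Φ.faceCoarsePt n x = Φ.centre + (Φ.period : ℤ) • ((2 * (m : ℤ)) • faceMap x) := by
    simp only [faceCoarsePt, hm, smul_smul]; push_cast; ring_nf
  rw [e, Φ.real_faceGoodEvent_shift]

/-! ## §3 `9`-dependence: far coarse edges depend on disjoint sets of edges of `G` -/

/-- The edges of `G` on which the state of the face coarse edge `e` depends: for `e = {x, x + eᵢ}`, the edges over the region
`hexBall (c + 2n·faceMap x + n·faceDir i) 6n` (none for other pairs). [cite: DuminilCopinSidoraviciusTassion2016, §2.2] -/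
def faceCoarseRegion (n : ℕ) (e : Sym2 (Site 2)) : Set (Sym2 V) :=
  {d | ∃ (x : Site 2) (i : Fin 2), e = s(x, x + Pi.single i 1) ∧
    d ∈ Set.sym2 (Φ.lift (hexBall (Φ.faceCoarsePt n x + (n : ℤ) • faceDir i) (6 * n)))}

/-- Events of the coarse configuration determined by the coarse edges in `F` pull back to events determined by the edges of `G` in
`⋃_{e ∈ F} faceCoarseRegion e`. [cite: DuminilCopinSidoraviciusTassion2016, §2.2 ("being good depends only on the state of the edges in a finite box")] -/
theorem determinedBy_preimage_faceCoarseConfig (n u : ℕ) {A : Set (BondConfig (Site 2))} {F : Finset (Sym2 (Site 2))}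
    (hA : DeterminedBy A (↑F : Set (Sym2 (Site 2)))) : DeterminedBy (Φ.faceCoarseConfig n u ⁻¹' A) (⋃ e ∈ F, Φ.faceCoarseRegion n e) := by
  rw [determinedBy_iff] at hA ⊢
  intro ω ω' h
  have key : ∀ e ∈ F, (e ∈ Φ.faceCoarseConfig n u ω ↔ e ∈ Φ.faceCoarseConfig n u ω') := by
    intro e he
    simp only [faceCoarseConfig, Set.mem_setOf_eq]
    refine exists_congr fun x => exists_congr fun i => and_congr_right fun hex => ?_
    refine (determinedBy_iff _ _).1 (Φ.determinedBy_faceGoodEvent n u (Φ.faceCoarsePt n x) i) ω ω' ?_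
    set R := Set.sym2 (Φ.lift (hexBall (Φ.faceCoarsePt n x + (n : ℤ) • faceDir i) (6 * n))) with hR
    have hsub : R ⊆ ⋃ e ∈ F, Φ.faceCoarseRegion n e := fun d hd => Set.mem_biUnion (Finset.mem_coe.2 he) ⟨x, i, hex, hd⟩
    calc ω ∩ R = (ω ∩ ⋃ e ∈ F, Φ.faceCoarseRegion n e) ∩ R := by rw [Set.inter_assoc, Set.inter_eq_right.2 hsub]
      _ = (ω' ∩ ⋃ e ∈ F, Φ.faceCoarseRegion n e) ∩ R := by rw [h]
      _ = ω' ∩ R := by rw [Set.inter_assoc, Set.inter_eq_right.2 hsub]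
  simp only [Set.mem_preimage]
  apply hA
  ext e
  simp only [Set.mem_inter_iff, Finset.mem_coe]
  constructor
  · rintro ⟨h1, h2⟩; exact ⟨(key e h2).1 h1, h2⟩
  · rintro ⟨h1, h2⟩; exact ⟨(key e h2).2 h1, h2⟩

/-- **`9`-dependence** (`n ≥ 1`): face coarse edges whose vertices are at sup-distance `≥ 9` depend on disjoint sets of edges of `G` (their regions have
`triNorm`-radius `6n` about centres `≥ 2n·9 − 4n = 14n` apart). [cite: DuminilCopinSidoraviciusTassion2016, §2.2 ("4-dependent")] -/
theorem disjoint_faceCoarseRegion {n : ℕ} (hn : 1 ≤ n) {F₁ F₂ : Finset (Sym2 (Site 2))}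
    (hfar : ∀ e₁ ∈ F₁, ∀ e₂ ∈ F₂, ∀ a ∈ e₁, ∀ b ∈ e₂, (9 : ℤ) ≤ max |a 0 - b 0| |a 1 - b 1|) :
    Disjoint (⋃ e ∈ F₁, Φ.faceCoarseRegion n e) (⋃ e ∈ F₂, Φ.faceCoarseRegion n e) := by
  rw [Set.disjoint_left]
  intro d hd1 hd2
  simp only [Set.mem_iUnion, faceCoarseRegion, Set.mem_setOf_eq, exists_prop] at hd1 hd2
  obtain ⟨e₁, he₁, x₁, i₁, hex₁, hd₁⟩ := hd1
  obtain ⟨e₂, he₂, x₂, i₂, hex₂, hd₂⟩ := hd2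
  have h9 := hfar e₁ he₁ e₂ he₂ x₁ (by rw [hex₁]; exact Sym2.mem_mk_left _ _) x₂ (by rw [hex₂]; exact Sym2.mem_mk_left _ _)
  obtain ⟨v, hv⟩ : ∃ v, v ∈ d := ⟨d.out.1, Sym2.out_fst_mem d⟩
  have hv₁ := Set.mem_sym2_iff_subset.1 hd₁ hv
  have hv₂ := Set.mem_sym2_iff_subset.1 hd₂ hv
  rw [mem_lift, mem_hexBall] at hv₁ hv₂
  have nsymm : ∀ u w : Site 2, triNorm (u - w) = triNorm (w - u) := fun u w => by
    rw [show u - w = -(w - u) by abel]; simp only [triNorm, Pi.neg_apply, ← neg_add, abs_neg]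
  set c₁ := Φ.faceCoarsePt n x₁ + (n : ℤ) • faceDir i₁ with hc₁
  set c₂ := Φ.faceCoarsePt n x₂ + (n : ℤ) • faceDir i₂ with hc₂
  -- the two region centres are within `12n` of each other through `sh v` …
  have hnear : triNorm (c₁ - c₂) ≤ 12 * n := by
    have t := triNorm_sub_le_triNorm_sub_add c₁ (Φ.sh v) c₂
    rw [nsymm c₁ (Φ.sh v)] at t; push_cast at hv₁ hv₂; linarith
  -- … but `c₁ − c₂ = 2n·faceMap (x₁ − x₂) − (n·faceDir i₂ − n·faceDir i₁)` has `triNorm ≥ 18n − 4n`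
  have hx : (9 : ℤ) ≤ triNorm (faceMap (x₁ - x₂)) := by
    rcases le_max_iff.1 h9 with h | h
    · exact h.trans (by have := (abs_le_triNorm_faceMap (x₁ - x₂)).1; rwa [Pi.sub_apply] at this)
    · exact h.trans (by have := (abs_le_triNorm_faceMap (x₁ - x₂)).2; rwa [Pi.sub_apply] at this)
  set A : Site 2 := ((2 * n : ℕ) : ℤ) • faceMap (x₁ - x₂) with hA
  set E : Site 2 := (n : ℤ) • faceDir i₂ - (n : ℤ) • faceDir i₁ with hE
  have hAD : A - (c₁ - c₂) = E := by
    simp only [hA, hE, hc₁, hc₂, faceCoarsePt, faceMap_sub, smul_sub]; push_cast; abel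
  have hA' : triNorm A = (2 * n : ℕ) * triNorm (faceMap (x₁ - x₂)) := by rw [hA, triNorm_natMul]
  have hE' : triNorm E ≤ 4 * n := by
    have t := triNorm_sub_le_triNorm_sub_add ((n : ℤ) • faceDir i₂) 0 ((n : ℤ) • faceDir i₁)
    rw [sub_zero, triNorm_natMul_faceDir, nsymm 0, sub_zero, triNorm_natMul_faceDir] at t
    rw [hE]; linarith
  have hfar' : 14 * (n : ℤ) ≤ triNorm (c₁ - c₂) := by
    have t := triNorm_sub_le_triNorm_sub_add A (c₁ - c₂) 0
    rw [sub_zero, hAD, sub_zero] at t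
    have h18 : 18 * (n : ℤ) ≤ triNorm A := by rw [hA']; push_cast; nlinarith [hx, Nat.cast_nonneg (α := ℤ) n]
    linarith
  have : (n : ℤ) ≥ 1 := by exact_mod_cast hn
  linarith

end HexShadow

end Summit.CriticalPhenomena.PercolationContinuityZ3.Theorems.Transplant

end
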